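import Summits.Ventures.Crystal3D.Theorems.StickyWulffConstantGenericWallFloorRayTerraceMirror
import Summits.Ventures.Crystal3D.Theorems.StickyWulffConstantGenericWallFloorStackPushForm
import Summits.Ventures.Crystal3D.Theorems.StickyWulffConstantGenericWallFloorAtDirsDown
import HarnessLib

/-!
# The terrace-steered steep family, part 6: the W1 hypothesis `hdirs` AS TYPED by the conditional ledgers
# (crux `GenericWallFloor`, stmt-Ventures-19480, line `WallLedgerG`)

HONEST FRAMING. Venture `Summits/Ventures/Crystal3D` (cell `crystal3d-full`), helper `--supports` the crux
`GenericWallFloor` (stmt-Ventures-19480) of `route-Ventures-StickyWulffConstant`, REGISTERED line `WallLedgerG`, open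
stub `stub_twoSlabAdhesion`.  Rung credit only; F-C1 not moved; NOT the stub; census-free, standard axioms.

Turnkey glue: 19480-p2's W1-conditional one-sided ledgers (`twoSlabAdhesion_stackLedger_oneSided_dirs` /
`…oneSidedDown_dirs`, `…AtDirs` / `…AtDirsDown`) take `hdirs` in the TOP-entry sign form
`∀ e rest, stk = e :: rest → 0 ≤ (e.frame e.dir) 2` (resp. `≤ 0`).  Parts 2–4 give the ∀-entry form with the constant
`1/2 − ‖A.symm w − w₀‖`; p2's `hdirs_of_forall_mem_inner` / `hdirsDown_of_forall_mem_inner` convert.  So: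
* `hdirs_terrace_up` — grain walking UP (`w = e₃`): whenever `‖A.symm e₃ − w₀‖ ≤ 1/2`;
* `hdirs_terrace_down` — grain walking DOWN (`w = −e₃`): whenever `‖A.symm (−e₃) − w₀‖ ≤ 1/2`;
* `hdirs_terrace_up_mirror` / `hdirs_terrace_down_mirror` — the mirror slot (frame `A ∘ S`, steering `(32,34,33)`).
(`w₀`: cubic `(1,1,4)/(3√2)`; steering data `cubicCoords (A.symm z) = t • (34,32,33)`, `t > 0`, from
`exists_terrace_steering`.)
WHAT THIS IS NOT: not the ledger, not `hfar`, no packing statement; F-C1 not moved.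
-/

noncomputable section

namespace Summit.Ventures.Crystal3D.Theorems

open Summit.Ventures.Crystal3D Finset Matrix
open scoped InnerProductSpace

/-- **W1 `hdirs` (floor form) for the terrace family of a grain walking UP.** -/
theorem hdirs_terrace_up (A : EuclideanSpace ℝ (Fin 3) ≃ₗᵢ[ℝ] EuclideanSpace ℝ (Fin 3))
    {z w₀ : EuclideanSpace ℝ (Fin 3)} {t : ℝ}
    (hZ : cubicCoords (A.symm z) = t • (![(34 : ℝ), 32, 33] : Fin 3 → ℝ)) (ht : 0 < t)
    (hw₀ : cubicCoords w₀ = (3 * Real.sqrt 2)⁻¹ • (![(1 : ℝ), 1, 4] : Fin 3 → ℝ))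
    (hnear : ‖A.symm (EuclideanSpace.single (2 : Fin 3) (1 : ℝ)) - w₀‖ ≤ 1 / 2) :
    ∀ stk : List WalkEntry, StackSound z stk → StackWF z stk → stk.getLast? = some ⟨A, slotSite 8, 0⟩ →
      ∀ e rest, stk = e :: rest → 0 ≤ (e.frame e.dir) 2 :=
  hdirs_of_forall_mem_inner (by linarith) (stack_dirs_terrace_of_near A hZ ht hw₀ _)

/-- **W1 `hdirs` (ceiling form) for the terrace family of a grain walking DOWN.** -/
theorem hdirs_terrace_down (A : EuclideanSpace ℝ (Fin 3) ≃ₗᵢ[ℝ] EuclideanSpace ℝ (Fin 3))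
    {z w₀ : EuclideanSpace ℝ (Fin 3)} {t : ℝ}
    (hZ : cubicCoords (A.symm z) = t • (![(34 : ℝ), 32, 33] : Fin 3 → ℝ)) (ht : 0 < t)
    (hw₀ : cubicCoords w₀ = (3 * Real.sqrt 2)⁻¹ • (![(1 : ℝ), 1, 4] : Fin 3 → ℝ))
    (hnear : ‖A.symm (-EuclideanSpace.single (2 : Fin 3) (1 : ℝ)) - w₀‖ ≤ 1 / 2) :
    ∀ stk : List WalkEntry, StackSound z stk → StackWF z stk → stk.getLast? = some ⟨A, slotSite 8, 0⟩ →
      ∀ e rest, stk = e :: rest → (e.frame e.dir) 2 ≤ 0 :=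
  hdirsDown_of_forall_mem_inner (by linarith) (stack_dirs_terrace_of_near A hZ ht hw₀ _)

/-- **W1 `hdirs` (floor form) for the MIRROR slot of a grain walking UP** (frame `A ∘ S`). -/
theorem hdirs_terrace_up_mirror (A : EuclideanSpace ℝ (Fin 3) ≃ₗᵢ[ℝ] EuclideanSpace ℝ (Fin 3))
    {z w₀ : EuclideanSpace ℝ (Fin 3)} {t : ℝ}
    (hZ : cubicCoords (A.symm z) = t • (![(32 : ℝ), 34, 33] : Fin 3 → ℝ)) (ht : 0 < t)
    (hw₀ : cubicCoords w₀ = (3 * Real.sqrt 2)⁻¹ • (![(1 : ℝ), 1, 4] : Fin 3 → ℝ))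
    (hnear : ‖A.symm (EuclideanSpace.single (2 : Fin 3) (1 : ℝ)) - w₀‖ ≤ 1 / 2) :
    ∀ stk : List WalkEntry, StackSound z stk → StackWF z stk →
      stk.getLast? = some ⟨(ℝ ∙ slotSite 1)ᗮ.reflection.trans A, slotSite 8, 0⟩ →
      ∀ e rest, stk = e :: rest → 0 ≤ (e.frame e.dir) 2 :=
  hdirs_of_forall_mem_inner (by linarith) (stack_dirs_terrace_mirror A hZ ht hw₀ _)

/-- **W1 `hdirs` (ceiling form) for the MIRROR slot of a grain walking DOWN** (frame `A ∘ S`). -/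
theorem hdirs_terrace_down_mirror (A : EuclideanSpace ℝ (Fin 3) ≃ₗᵢ[ℝ] EuclideanSpace ℝ (Fin 3))
    {z w₀ : EuclideanSpace ℝ (Fin 3)} {t : ℝ}
    (hZ : cubicCoords (A.symm z) = t • (![(32 : ℝ), 34, 33] : Fin 3 → ℝ)) (ht : 0 < t)
    (hw₀ : cubicCoords w₀ = (3 * Real.sqrt 2)⁻¹ • (![(1 : ℝ), 1, 4] : Fin 3 → ℝ))
    (hnear : ‖A.symm (-EuclideanSpace.single (2 : Fin 3) (1 : ℝ)) - w₀‖ ≤ 1 / 2) :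
    ∀ stk : List WalkEntry, StackSound z stk → StackWF z stk →
      stk.getLast? = some ⟨(ℝ ∙ slotSite 1)ᗮ.reflection.trans A, slotSite 8, 0⟩ →
      ∀ e rest, stk = e :: rest → (e.frame e.dir) 2 ≤ 0 :=
  hdirsDown_of_forall_mem_inner (by linarith) (stack_dirs_terrace_mirror A hZ ht hw₀ _)

end Summit.Ventures.Crystal3D.Theorems

end
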